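import Literature.NumberTheory.Sieve.PolynomialCongruencesProofs
import Literature.NumberTheory.Sieve.DivisorBound
import Mathlib.RingTheory.Polynomial.Eisenstein.Basic
import Mathlib.NumberTheory.ArithmeticFunction.Misc
import HarnessLib

/-!
# Heath-Brown 2001 (PLMS), §7: cube roots of `2 (mod q)` and the count
# `#{N(R) ≤ Q : R ∣ d + c∛2} ≪ Q^ε` in root language

Topic `Literature/NumberTheory/Sieve`; a PROVED arithmetic layer (definitions with bodies, no named
facts) under the named fact `Irving2015_largestPrimeFactor_cubic` (`LargestPrimeFactorCubic.lean`),
first input of Heath-Brown's **Lemma 10** (this seat's main-term programme, Lemma 7).  Source: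
D. R. Heath-Brown, *The largest prime factor of `X³ + 2`*, Proc. London Math. Soc. (3) 82 (2001)
554–596, §7 pp. 23–25 of the held text.  In the proof of Lemma 10 the ideals `R` with `ρ(R) = 1`
are parametrised by "a rational integer `k`, say, such that `k ≡ ∛2 (mod R)`", the condition
`R ∣ u − v∛2` "is therefore equivalent to `R ∣ u − vk`" and then to `N(R) ∣ u − vk` (p. 24), and the
error terms are controlled by "`#{N(R) ≤ Q : R ∣ d + c∛2} ≪ Q^ε`" (p. 24, twice).

In ROOT LANGUAGE (pairs `(q, k)` with `q ∣ k³ − 2`, `0 ≤ k < q`, in place of `(N(R), k)`; the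
bijection with first-degree ideals is the parallel seat's `LargestPrimeFactorCubicRoots`) this file
PROVES:

* `cubicF = X³ − 2` (irreducible, Eisenstein at `2`), `rootsCube q = {k < q : q ∣ k³ − 2}`,
  `card_rootsCube` (`= ρ_{X³−2}(q)`), **`exists_card_rootsCube_le`** (`#rootsCube q ≤ C₀ 3^{ω(q)}`,
  Hensel/Nagell via the tree's `polyRootCountMod_le_of_prime_pow_bounds`) and
  **`exists_card_rootsCube_le_rpow`** (`≤ C_ε q^ε`, divisor bound);
* `dvd_cube_sub_two_mul_cube` — `q ∣ k³ − 2`, `q ∣ νk − d` ⇒ `q ∣ d³ − 2ν³`;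
  `eq_zero_of_cube_eq_two_mul_cube` — `d³ = 2ν³ ⇒ d = ν = 0` (descent: `∛2 ∉ ℚ`);
* **`card_rootPairs_dvd_le`** — for `(ν, d) ≠ (0, 0)`:
  `#{(q, k) : 1 ≤ q ≤ Q, k ∈ rootsCube q, q ∣ νk − d} ≤ C_ε Q^ε · τ(|d³ − 2ν³|)`
  (the pairs have `q ∣ d³ − 2ν³ ≠ 0`).

## References

* D. R. Heath-Brown, *The largest prime factor of `X³ + 2`*, Proc. London Math. Soc. (3) 82 (2001)
  554–596, §7, proof of Lemma 10, pp. 23–25. [`HeathBrown2001LargestPrimeFactorCubic`]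

## Mathlib / tree search

Tree: `polyRootCountMod`, `polyRootCountMod_le_of_prime_pow_bounds` (`PolynomialCongruencesProofs`),
`exists_forall_prime_polyRootCountMod_pow_eq`, `exists_polyRootCountMod_prime_pow_le`
(`PolynomialCongruencesRootCount`), `exists_card_divisors_le_mul_rpow` (`DivisorBound`).
Mathlib: `Polynomial.IsEisensteinAt.irreducible`, `Nat.card_divisors`, `Int.prime_two`,
`Prime.dvd_of_dvd_pow`.
-/

noncomputable section

open Finset Polynomial

namespace Literature.NumberTheory.Sieve.HeathBrown2001

/-! ### `X³ − 2` and its roots modulo `q` -/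

/-- The polynomial `X³ − 2 ∈ ℤ[X]`. [folklore] -/
def cubicF : ℤ[X] := X ^ 3 - C 2

/-- `X³ − 2` is monic of degree `3`. [folklore] -/
theorem cubicF_monic : cubicF.Monic ∧ cubicF.natDegree = 3 :=
  ⟨monic_X_pow_sub_C _ (by norm_num), natDegree_X_pow_sub_C⟩

/-- `X³ − 2` is irreducible (Eisenstein at `2`). [folklore] -/
theorem cubicF_irreducible : Irreducible cubicF := by
  set P : Ideal ℤ := Ideal.span {(2 : ℤ)} with hP
  have hPprime : P.IsPrime := Ideal.isPrime_span_singleton_of_prime (by norm_num : Prime (2 : ℤ))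
  obtain ⟨hmonic, hdeg⟩ := cubicF_monic
  have hE : cubicF.IsEisensteinAt P := by
    refine ⟨?_, ?_, ?_⟩
    · rw [hmonic.leadingCoeff, hP, Ideal.mem_span_singleton]; norm_num
    · intro k hk
      rw [hdeg] at hk
      rw [cubicF, coeff_sub, coeff_X_pow, coeff_C, if_neg hk.ne, zero_sub, hP, Ideal.mem_span_singleton]
      split_ifs with hk0
      · norm_num
      · simp
    · rw [cubicF, coeff_sub, coeff_X_pow, coeff_C, if_neg (by omega : (0 : ℕ) ≠ 3), zero_sub, if_pos rfl,
        hP, Ideal.span_singleton_pow, Ideal.mem_span_singleton]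
      norm_num
  exact hE.irreducible hPprime hmonic.isPrimitive (by rw [hdeg]; omega)

/-- The cube roots of `2` modulo `q`: `{0 ≤ k < q : q ∣ k³ − 2}` (Heath-Brown's `k ≡ ∛2 (mod R)`).
[cite: HeathBrown2001LargestPrimeFactorCubic, §7 p. 24 (k ≡ ∛2 (mod R))] -/
def rootsCube (q : ℕ) : Finset ℕ := (range q).filter fun k : ℕ => (q : ℤ) ∣ (k : ℤ) ^ 3 - 2

/-- Membership in `rootsCube`. [folklore] -/
theorem mem_rootsCube {q k : ℕ} : k ∈ rootsCube q ↔ k < q ∧ (q : ℤ) ∣ (k : ℤ) ^ 3 - 2 := by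
  rw [rootsCube, mem_filter, mem_range]

/-- `#rootsCube q = ρ_{X³−2}(q)`. [folklore] -/
theorem card_rootsCube (q : ℕ) : #(rootsCube q) = polyRootCountMod ![cubicF] q := by
  unfold polyRootCountMod rootsCube
  congr 1
  ext k
  simp only [mem_filter, Fin.prod_univ_one, Matrix.cons_val_fin_one, cubicF, eval_sub, eval_pow, eval_X,
    eval_C]

/-- **`#rootsCube q ≤ C₀ · 3^{ω(q)}`** for an absolute `C₀ ≥ 1` (Hensel at the good primes, Nagell at the
others, multiplicativity). [folklore] -/
theorem exists_card_rootsCube_le :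
    ∃ C₀ : ℕ, 1 ≤ C₀ ∧ ∀ q : ℕ, #(rootsCube q) ≤ C₀ * 3 ^ q.primeFactors.card := by
  have hdeg : 0 < cubicF.natDegree := by rw [cubicF_monic.2]; norm_num
  obtain ⟨E, hE, hgood⟩ := exists_forall_prime_polyRootCountMod_pow_eq cubicF_irreducible hdeg
  obtain ⟨M, hM, hbad⟩ := exists_polyRootCountMod_prime_pow_le cubicF_irreducible hdeg
  refine ⟨M ^ E.primeFactors.card, Nat.one_le_pow _ _ hM, fun q => ?_⟩
  rw [card_rootsCube]
  refine polyRootCountMod_le_of_prime_pow_bounds cubicF hE hM (n := 3) ?_ ?_ q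
  · intro p hp hpE a ha
    obtain ⟨h1, h2⟩ := hgood p hp hpE a ha
    rw [h1, ← cubicF_monic.2]
    exact h2
  · intro p hp a
    have := hbad p hp a
    rwa [cubicF_monic.2] at this

/-- `3^{ω(q)} ≤ τ(q)²` for `q ≠ 0` (`τ(q) = ∏ (aₚ + 1) ≥ 2^{ω(q)}`). [folklore] -/
theorem three_pow_card_primeFactors_le_sq {q : ℕ} (hq : q ≠ 0) :
    3 ^ q.primeFactors.card ≤ (#q.divisors) ^ 2 := by
  rw [Nat.card_divisors hq, ← prod_pow, ← prod_const]
  refine prod_le_prod' fun p hp => ?_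
  have : 1 ≤ q.factorization p :=
    (Nat.prime_of_mem_primeFactors hp).factorization_pos_of_dvd hq (Nat.dvd_of_mem_primeFactors hp)
  nlinarith

/-- **`#rootsCube q ≤ C_ε q^ε`** for every `ε > 0` (`q ≥ 1`).
[cite: HeathBrown2001LargestPrimeFactorCubic, §7 p. 24 ("≪ Q^ε")] -/
theorem exists_card_rootsCube_le_rpow {ε : ℝ} (hε : 0 < ε) :
    ∃ C : ℝ, 1 ≤ C ∧ ∀ q : ℕ, q ≠ 0 → (#(rootsCube q) : ℝ) ≤ C * (q : ℝ) ^ ε := by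
  obtain ⟨C₀, hC₀, h₀⟩ := exists_card_rootsCube_le
  obtain ⟨C₁, hC₁, h₁⟩ := exists_card_divisors_le_mul_rpow (half_pos hε)
  refine ⟨C₀ * C₁ ^ 2, ?_, fun q hq => ?_⟩
  · have : (1 : ℝ) ≤ C₀ := by exact_mod_cast hC₀
    nlinarith
  have hτ := h₁ q hq
  have h3 : ((3 ^ q.primeFactors.card : ℕ) : ℝ) ≤ ((#q.divisors : ℕ) : ℝ) ^ 2 := by
    exact_mod_cast three_pow_card_primeFactors_le_sq hq
  have hq0 : (0 : ℝ) ≤ (q : ℝ) ^ (ε / 2) := Real.rpow_nonneg (Nat.cast_nonneg _) _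
  calc (#(rootsCube q) : ℝ) ≤ ((C₀ * 3 ^ q.primeFactors.card : ℕ) : ℝ) := by exact_mod_cast h₀ q
    _ = (C₀ : ℝ) * ((3 ^ q.primeFactors.card : ℕ) : ℝ) := by push_cast; ring
    _ ≤ (C₀ : ℝ) * ((#q.divisors : ℕ) : ℝ) ^ 2 := by gcongr
    _ ≤ (C₀ : ℝ) * (C₁ * (q : ℝ) ^ (ε / 2)) ^ 2 := by gcongr
    _ = C₀ * C₁ ^ 2 * ((q : ℝ) ^ (ε / 2) * (q : ℝ) ^ (ε / 2)) := by ring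
    _ = C₀ * C₁ ^ 2 * (q : ℝ) ^ ε := by rw [← Real.rpow_add_of_nonneg (Nat.cast_nonneg _) (by linarith) (by linarith)]; ring_nf

/-! ### The divisibility `q ∣ d³ − 2ν³` and `∛2 ∉ ℚ` -/

/-- If `q ∣ k³ − 2` and `q ∣ νk − d` then `q ∣ d³ − 2ν³` ("`d³ ≡ ν³k³ ≡ 2ν³`").
[cite: HeathBrown2001LargestPrimeFactorCubic, §7 p. 24] -/
theorem dvd_cube_sub_two_mul_cube {q k ν d : ℤ} (hk : q ∣ k ^ 3 - 2) (h : q ∣ ν * k - d) :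
    q ∣ d ^ 3 - 2 * ν ^ 3 := by
  have e : d ^ 3 - 2 * ν ^ 3 = -(ν * k - d) * (d ^ 2 + d * (ν * k) + (ν * k) ^ 2) + ν ^ 3 * (k ^ 3 - 2) := by
    ring
  rw [e]
  exact dvd_add (dvd_mul_of_dvd_left (dvd_neg.mpr h) _) (dvd_mul_of_dvd_right hk _)

/-- **`∛2` is irrational**, integrally: `d³ = 2ν³ ⇒ d = 0` (infinite descent at `2`). [folklore] -/
theorem eq_zero_of_cube_eq_two_mul_cube {d ν : ℤ} (h : d ^ 3 = 2 * ν ^ 3) : d = 0 ∧ ν = 0 := by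
  have h2 : Prime (2 : ℤ) := Int.prime_two
  suffices key : ∀ n : ℕ, ∀ d ν : ℤ, d.natAbs = n → d ^ 3 = 2 * ν ^ 3 → d = 0 by
    have hd := key _ d ν rfl h
    refine ⟨hd, ?_⟩
    rw [hd] at h
    have : ν ^ 3 = 0 := by linarith [h]
    exact pow_eq_zero_iff (by norm_num) |>.mp this
  intro n
  induction n using Nat.strong_induction_on with
  | _ n ih =>
    intro d ν hn h
    by_contra hd0
    have hd2 : (2 : ℤ) ∣ d := h2.dvd_of_dvd_pow (n := 3) ⟨ν ^ 3, by linarith⟩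
    obtain ⟨d', rfl⟩ := hd2
    have hν3 : ν ^ 3 = 4 * d' ^ 3 := by linarith
    have hν2 : (2 : ℤ) ∣ ν := h2.dvd_of_dvd_pow (n := 3) ⟨2 * d' ^ 3, by linarith⟩
    obtain ⟨ν', rfl⟩ := hν2
    have h' : d' ^ 3 = 2 * ν' ^ 3 := by linarith
    have hd'0 : d' ≠ 0 := fun h0 => hd0 (by rw [h0]; ring)
    have hlt : d'.natAbs < n := by
      rw [← hn, Int.natAbs_mul]
      have : 0 < d'.natAbs := Int.natAbs_pos.mpr hd'0
      simp only [Int.reduceAbs]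
      omega
    exact hd'0 (ih _ hlt d' ν' rfl h')

/-- Hence `d³ − 2ν³ ≠ 0` unless `ν = d = 0`. [folklore] -/
theorem cube_sub_two_mul_cube_ne_zero {ν d : ℤ} (h : ¬ (ν = 0 ∧ d = 0)) : d ^ 3 - 2 * ν ^ 3 ≠ 0 := by
  intro h0
  obtain ⟨hd, hν⟩ := eq_zero_of_cube_eq_two_mul_cube (sub_eq_zero.mp h0)
  exact h ⟨hν, hd⟩

/-! ### Counting the pairs `(q, k)` with `q ∣ νk − d` -/

/-- The pairs `(q, k)`, `1 ≤ q ≤ Q`, `k ∈ rootsCube q` (Heath-Brown's "`N(R) ≤ Q, ρ(R) = 1`").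
[cite: HeathBrown2001LargestPrimeFactorCubic, Lemma 10] -/
def rootPairs (Q : ℕ) : Finset (Σ _ : ℕ, ℕ) := (Icc 1 Q).sigma fun q => rootsCube q

/-- **`#{(q, k) : q ≤ Q, k ∈ rootsCube q, q ∣ νk − d} ≤ C Q^ε τ(|d³ − 2ν³|)`** for `(ν, d) ≠ (0, 0)`,
given `#rootsCube q ≤ C q^ε` (`q ≥ 1`).
[cite: HeathBrown2001LargestPrimeFactorCubic, §7 p. 24 ("#{N(R) ≤ Q : R ∣ d + c∛2} ≪ Q^ε")] -/
theorem card_rootPairs_dvd_le {C ε : ℝ} (hC : 0 ≤ C) (hε : 0 ≤ ε)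
    (hroot : ∀ q : ℕ, q ≠ 0 → (#(rootsCube q) : ℝ) ≤ C * (q : ℝ) ^ ε)
    (Q : ℕ) {ν d : ℤ} (hνd : ¬ (ν = 0 ∧ d = 0)) :
    (#((rootPairs Q).filter fun qk => ((qk.1 : ℕ) : ℤ) ∣ ν * qk.2 - d) : ℝ) ≤
      C * (Q : ℝ) ^ ε * #((d ^ 3 - 2 * ν ^ 3).natAbs.divisors) := by
  classical
  set n : ℕ := (d ^ 3 - 2 * ν ^ 3).natAbs with hn
  have hn0 : n ≠ 0 := Int.natAbs_ne_zero.mpr (cube_sub_two_mul_cube_ne_zero hνd)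
  -- fibre over `q`
  have hsigma : (rootPairs Q).filter (fun qk => ((qk.1 : ℕ) : ℤ) ∣ ν * qk.2 - d) =
      (Icc 1 Q).sigma fun q => (rootsCube q).filter fun k : ℕ => (q : ℤ) ∣ ν * k - d := by
    ext ⟨q, k⟩
    simp only [rootPairs, mem_filter, mem_sigma]
    tauto
  rw [hsigma, card_sigma]
  push_cast
  -- only `q ∣ n` contribute
  have hzero : ∀ q ∈ Icc 1 Q, ¬ q ∣ n →
      (#((rootsCube q).filter fun k : ℕ => (q : ℤ) ∣ ν * k - d) : ℝ) = 0 := by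
    intro q _ hqn
    rw [Nat.cast_eq_zero, card_eq_zero, filter_eq_empty_iff]
    intro k hk hdvd
    exact hqn (Int.natCast_dvd.mp (dvd_cube_sub_two_mul_cube (mem_rootsCube.mp hk).2 hdvd))
  rw [← sum_filter_of_ne (p := fun q => q ∣ n) (fun q hq hne => by
    by_contra hqn; exact hne (hzero q hq hqn))]
  -- each term is at most `C Q^ε`
  have hQε : ∀ q ∈ (Icc 1 Q).filter (fun q => q ∣ n),
      (#((rootsCube q).filter fun k : ℕ => (q : ℤ) ∣ ν * k - d) : ℝ) ≤ C * (Q : ℝ) ^ ε := by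
    intro q hq
    rw [mem_filter, mem_Icc] at hq
    have hq0 : q ≠ 0 := by omega
    calc (#((rootsCube q).filter fun k : ℕ => (q : ℤ) ∣ ν * k - d) : ℝ) ≤ #(rootsCube q) := by
          exact_mod_cast card_filter_le _ _
      _ ≤ C * (q : ℝ) ^ ε := hroot q hq0
      _ ≤ C * (Q : ℝ) ^ ε := by
          gcongr
          exact_mod_cast hq.1.2
  have hsub : (Icc 1 Q).filter (fun q => q ∣ n) ⊆ n.divisors := by
    intro q hq
    rw [mem_filter] at hq
    exact Nat.mem_divisors.mpr ⟨hq.2, hn0⟩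
  calc ∑ q ∈ (Icc 1 Q).filter (fun q => q ∣ n), (#((rootsCube q).filter fun k : ℕ => (q : ℤ) ∣ ν * k - d) : ℝ)
      ≤ ∑ _q ∈ (Icc 1 Q).filter (fun q => q ∣ n), C * (Q : ℝ) ^ ε := sum_le_sum hQε
    _ = #((Icc 1 Q).filter (fun q => q ∣ n)) * (C * (Q : ℝ) ^ ε) := by rw [sum_const, nsmul_eq_mul]
    _ ≤ #(n.divisors) * (C * (Q : ℝ) ^ ε) := by gcongr
    _ = C * (Q : ℝ) ^ ε * #(n.divisors) := by ring

end Literature.NumberTheory.Sieve.HeathBrown2001
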